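import Summits.MatrixMultiplication.MatrixMultiplication.Theorems.ObstructionDescentDescentLaw

set_option linter.dupNamespace false

/-!
# Obstruction descent, part W — THE EVEN-SPLIT DESCENT LAW (H20 one format down ⇒ the odd Strassen step)

`route-MatrixMultiplication-ObstructionDescent`, aside `InvariantSaturation` (stmt 32282); decomp-mm lens-3, NODE-g15;
the kernel anchor of the census's EVEN-SPLIT LAW H20 (census g10 K25, STATUS l.936/946) and of the ODD-STEP LAW of
lens-3 (STATUS l.947 (E5)).

**H20 at format `m'` (corner form).**  Every level-`3` vector `G` of the corner type `((3^{m'}))³` in the ambient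
format `m' + 1` (`G ∈ hwvSpace (rectType (m'+1) m' 3) (3m')`) has VANISHING `(2,2,…,2)`-COEFFICIENT in its secant
polynomial `G(Σ_{i<n} λ_i t_i)` at `n = 3m'/2` rank-one tensors `t_i` — «level 3 is apolar to products of squares»,
equivalently (bus l.947/951) «no degree-`3m'/2` invariant of `S²ℂ^{m'} ⊗ S²ℂ^{m'} ⊗ S²ℂ^{m'}` survives the pull-back
along the partial symmetric square».  The census proved it for `m' ∈ {4, 6, 8}` (slot-character mismatch, l.946;
Gale-free derivation l.951); it is vacuous when level `3` is empty at format `m'` (`m' = 2`, `m' = 7`, `m' ≥ 10`).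

**`evalT_eq_zero_of_evenSplit_pred` (this file).**  H20 at format `m'` ⟹ every level-`3` vector of the full format
`m' + 1` vanishes on all tensors of rank `≤ r` with `2r + 1 ≤ 3(m' + 1)`.  For EVEN `m'` this is one more than the
pair law (part K, `2r + 1 < 3m`): the ODD STRASSEN STEP `r_{m'+1}(3) ≥ (3m' + 4)/2` — `m' = 4`: `H₅ ∈ I(σ₇(ℂ⁵⊗ℂ⁵⊗ℂ⁵))`
(census: `c₄₁ = 0`, `r₅(3) = 8`), `m' = 8`: `F₉ ∈ I(σ₁₃)` (census K25: `r₉(3) = 14`); for `m' = 2` the hypothesis is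
vacuous (`evenSplit_pred_two`) and the conclusion is Strassen's range `R₃(3) ⊆ I(σ₄)` again (a second route to
part U's `evalT_eq_zero_of_level_three_three`).

MECHANISM.  As in part K: for `t_j = h·e₀₀₀` the `λ_j³`-coefficient of `Φ(λ) = f(Σ λ_i t_i)` is
`χ(h)·g(h⁻¹ Σ_{i≠j} λ_i t_i)` with `g = f^{(e₀₀₀)}` the top coefficient (part J); `g` has all exponents `≤ 2` (dead block
windows, `3 ∈ emptyLevels (m'+1) 2`), so its own secant polynomial at the `r − 1` remaining triads has every partial
degree `≤ 2` and total degree `3m'`; when `2(r−1) = 3m'` its only possible monomial is `Π λ_i²`, whose coefficient H20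
kills — here the NEW INPUT is `topCoeff_mem_hwvSpace_pred`: **the top coefficient `f^{(e₀₀₀)}` of a full-format level
vector IS a level vector of the corner type one format down** (Borel semi-invariance transported through the line
expansion, since `B³` fixes `e₀₀₀` up to the scalar `A₀₀B₀₀C₀₀`), so H20 applies to `g`; hence `deg_{λ_j} Φ ≤ 2` for
every `j` and `Φ = 0` once `2r < 3(m'+1)` (part H §1).

[cite: BurgisserIkenmeyer2011, §6.2] (Strassen's `σ_4`-range at format 3; the level-3 column),
[cite: BurgisserIkenmeyer2013, Prop. 4.2], [cite: LandsbergGCT2017, §8.3.4] (prolongation / polarisation).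
-/

open scoped BigOperators
open Finset

namespace Summit.MatrixMultiplication.MatrixMultiplication.Theorems.ObstructionCalculus

open Literature.Computability.AlgebraicComplexity (actTensor actTensor_apply actTensor_actTensor actTensor_one
  actTensor_zero actTensor_triad triad triad_apply tensorRank exists_eq_sum_triad_of_tensorRank_le)

/-! ### §1 Secant polynomials: partial degrees and the boundary coefficient -/

section Secant

variable {m : ℕ}

/-- Coefficients of `Q(s·u)`: `[u^n] Q(s u) = s^n [u^n] Q`. [folklore] -/
theorem coeff_comp_C_mul_X' (Q : Polynomial ℂ) (s : ℂ) (n : ℕ) :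
    (Q.comp (Polynomial.C s * Polynomial.X)).coeff n = s ^ n * Q.coeff n := by
  induction Q using Polynomial.induction_on' with
  | add p q hp hq => simp only [Polynomial.add_comp, Polynomial.coeff_add, hp, hq, mul_add]
  | monomial k a =>
      rw [← Polynomial.C_mul_X_pow_eq_monomial, Polynomial.mul_comp, Polynomial.C_comp, Polynomial.X_pow_comp, mul_pow,
        ← Polynomial.C_pow, ← mul_assoc, ← Polynomial.C_mul, Polynomial.coeff_C_mul_X_pow, Polynomial.coeff_C_mul_X_pow]
      split_ifs with h
      · subst h; ring
      · simp

/-- **Partial degrees of a secant polynomial.**  If `u ↦ g(y + u·t_i)` has degree `≤ δ` for every `y` and `i`, then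
`g(Σ_i λ_i t_i) ∈ ℂ[λ]` has degree `≤ δ` in each `λ_j`. [folklore] -/
theorem degreeOf_secant_le {r δ : ℕ} {g : MvPolynomial (Idx m) ℂ} (t : Fin r → Tensor ℂ m)
    (hline : ∀ (y : Tensor ℂ m) (i : Fin r), ∃ Q : Polynomial ℂ, Q.natDegree ≤ δ ∧
      ∀ u : ℂ, evalT (y + u • t i) g = Q.eval u) (j : Fin r) :
    (MvPolynomial.aeval
      (fun p : Idx m => ∑ i : Fin r, MvPolynomial.C (t i p.1 p.2.1 p.2.2) * MvPolynomial.X i) g).degreeOf j ≤ δ := by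
  refine degreeOf_le_of_lineDegree j fun c => ?_
  obtain ⟨Q, hQδ, hQ⟩ := hline (∑ l ∈ Finset.univ \ {j}, c l • t l) j
  refine ⟨Q, hQδ, fun u => ?_⟩
  rw [eval_secant, ← hQ u]
  have hfun : (fun l => Function.update c j u l • t l) = Function.update (fun l => c l • t l) j (u • t j) := by
    funext l
    by_cases hl : l = j
    · subst hl
      simp
    · simp [Function.update_of_ne hl]
  rw [hfun, Finset.sum_update_of_mem (Finset.mem_univ j), add_comm]

/-- **Secant vanishing at the boundary from ONE coefficient.**  Let `g` be homogeneous of degree `D` with line degree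
`≤ δ` along every `t_i` through every point, and `δ·r ≤ D`.  If (in the boundary case `δ·r = D`) the coefficient of
`Π_i λ_i^δ` in `g(Σ λ_i t_i)` vanishes, then `g(Σ λ_i t_i) = 0` identically: every monomial has all exponents `≤ δ` and
total degree `D ≥ δ r`, so `Π λ_i^δ` is the only candidate. [this node] -/
theorem secant_eq_zero_of_coeff {r D δ : ℕ} {g : MvPolynomial (Idx m) ℂ} (hg : g.IsHomogeneous D)
    (t : Fin r → Tensor ℂ m)
    (hline : ∀ (y : Tensor ℂ m) (i : Fin r), ∃ Q : Polynomial ℂ, Q.natDegree ≤ δ ∧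
      ∀ u : ℂ, evalT (y + u • t i) g = Q.eval u)
    (hD : δ * r ≤ D)
    (hcoeff : δ * r = D → MvPolynomial.coeff (Finsupp.equivFunOnFinite.symm fun _ : Fin r => δ)
      (MvPolynomial.aeval
        (fun p : Idx m => ∑ i : Fin r, MvPolynomial.C (t i p.1 p.2.1 p.2.2) * MvPolynomial.X i) g) = 0) :
    MvPolynomial.aeval
      (fun p : Idx m => ∑ i : Fin r, MvPolynomial.C (t i p.1 p.2.1 p.2.2) * MvPolynomial.X i) g = 0 := by
  set Φ := MvPolynomial.aeval
    (fun p : Idx m => ∑ i : Fin r, MvPolynomial.C (t i p.1 p.2.1 p.2.2) * MvPolynomial.X i) g with hΦ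
  by_contra hne
  obtain ⟨s, hs⟩ := MvPolynomial.ne_zero_iff.mp hne
  have hs' : s ∈ Φ.support := MvPolynomial.mem_support_iff.mpr hs
  have h1 : D = ∑ i ∈ s.support, s i := (secant_isHomogeneous t hg).degree_eq_sum_deg_support hs'
  have h2 : ∑ i ∈ s.support, s i = ∑ i, s i :=
    Finset.sum_subset (Finset.subset_univ _) fun i _ hi => Finsupp.notMem_support_iff.mp hi
  have h3 : ∀ i, s i ≤ δ := fun i => (MvPolynomial.monomial_le_degreeOf i hs').trans (degreeOf_secant_le t hline i)
  have h4 : ∑ i, s i ≤ ∑ _i : Fin r, δ := Finset.sum_le_sum fun i _ => h3 i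
  have h5 : ∑ _i : Fin r, δ = δ * r := by
    rw [Finset.sum_const, Finset.card_univ, Fintype.card_fin, smul_eq_mul, mul_comm]
  have h6 : ∑ i, s i = ∑ _i : Fin r, δ := by
    refine le_antisymm h4 ?_
    rw [h5, ← h2, ← h1]
    exact hD
  have h7 : ∀ i ∈ (Finset.univ : Finset (Fin r)), s i = δ := (Finset.sum_eq_sum_iff_of_le fun i _ => h3 i).mp h6
  have h8 : s = Finsupp.equivFunOnFinite.symm fun _ : Fin r => δ :=
    Finsupp.ext fun i => by rw [Finsupp.coe_equivFunOnFinite_symm]; exact h7 i (Finset.mem_univ i)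
  refine hs ?_
  rw [h8]
  refine hcoeff (le_antisymm hD ?_)
  rw [h1, h2, h6, h5]

end Secant

/-! ### §2 The top coefficient is a level vector one format down -/

section TopCoeffLevel

variable {m' : ℕ}

/-- An upper-triangular matrix maps `e₀` to `A₀₀ · e₀`. [bookkeeping] -/
theorem mulVec_single_zero_of_mem_borel {A : Matrix (Fin (m' + 1)) (Fin (m' + 1)) ℂ} (hA : A ∈ borel (m' + 1)) :
    A.mulVec (Pi.single 0 1) = A 0 0 • (Pi.single 0 1 : Fin (m' + 1) → ℂ) := by
  rw [Matrix.mulVec_single_one]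
  funext i
  by_cases hi : i = 0
  · subst hi
    simp
  · have h0 : A i 0 = 0 := hA.1 i 0 ((Fin.pos_iff_ne_zero).mpr hi)
    simp [hi, h0]

/-- The self type splits off the weight at index `0`: `Π_i A_ii^3… = A₀₀^k · (corner character)`. [bookkeeping] -/
theorem weightChar_rectType_succ (k : ℕ) (s : Fin 3) (A : Matrix (Fin (m' + 1)) (Fin (m' + 1)) ℂ) :
    weightChar (rectType (m' + 1) (m' + 1) k s) A = A 0 0 ^ k * weightChar (rectType (m' + 1) m' k s) A := by
  unfold weightChar
  rw [Fin.prod_univ_succ, Fin.prod_univ_succ]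
  have h0 : rectType (m' + 1) (m' + 1) k s 0 = k := rectType_self_apply k s 0
  have h0' : rectType (m' + 1) m' k s 0 = 0 := by
    simp only [rectType, Fin.val_zero, zero_add, ite_eq_right_iff]
    omega
  have hS : ∀ i : Fin m', rectType (m' + 1) m' k s i.succ = rectType (m' + 1) (m' + 1) k s i.succ := by
    intro i
    rw [rectType_self_apply]
    simp only [rectType, Fin.val_succ, ite_eq_left_iff]
    omega
  rw [h0, h0', pow_zero, one_mul]
  simp only [hS]

/-- **The top coefficient is a level vector of the corner type.**  For a level-`k` vector `f` of the full format
`m' + 1` and its top coefficient `g = f^{(e₀₀₀)}` (part J: `[u^k] f(y + u e₀₀₀) = g(y)`, `g` homogeneous of degree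
`k m'`): `g ∈ hwvSpace (rectType (m'+1) m' k) (k m')` — Borel semi-invariance descends through the line expansion because
`(A,B,C)·e₀₀₀ = A₀₀B₀₀C₀₀ · e₀₀₀` for upper-triangular `A, B, C`. [this node] -/
theorem topCoeff_mem_hwvSpace_pred {k : ℕ} {f g : MvPolynomial (Idx (m' + 1)) ℂ}
    (hf : f ∈ hwvSpace (rectType (m' + 1) (m' + 1) k) (k * (m' + 1))) (hghom : g.IsHomogeneous (k * m'))
    (hgtop : ∀ y : Tensor ℂ (m' + 1), ∃ Q : Polynomial ℂ, Q.natDegree ≤ k ∧ Q.coeff k = evalT y g ∧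
      ∀ u : ℂ, evalT (y + u • triad (Pi.single (0 : Fin (m' + 1)) (1 : ℂ)) (Pi.single 0 1) (Pi.single 0 1)) f =
        Q.eval u) :
    g ∈ hwvSpace (rectType (m' + 1) m' k) (k * m') := by
  refine ⟨hghom, fun A B C hA hB hC y => ?_⟩
  set c : ℂ := A 0 0 * B 0 0 * C 0 0 with hc
  have hc0 : c ≠ 0 := mul_ne_zero (mul_ne_zero (hA.2 0) (hB.2 0)) (hC.2 0)
  have hE : actTensor A B C (triad (Pi.single (0 : Fin (m' + 1)) (1 : ℂ)) (Pi.single 0 1) (Pi.single 0 1)) =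
      c • triad (Pi.single (0 : Fin (m' + 1)) (1 : ℂ)) (Pi.single 0 1) (Pi.single 0 1) := by
    rw [actTensor_triad, mulVec_single_zero_of_mem_borel hA, mulVec_single_zero_of_mem_borel hB,
      mulVec_single_zero_of_mem_borel hC, triad_smul_smul_smul]
  obtain ⟨Q₁, -, h₁, h₁'⟩ := hgtop (actTensor A B C y)
  obtain ⟨Q₂, -, h₂, h₂'⟩ := hgtop y
  set χ : ℂ := weightChar (rectType (m' + 1) (m' + 1) k 0) A * weightChar (rectType (m' + 1) (m' + 1) k 1) B *
    weightChar (rectType (m' + 1) (m' + 1) k 2) C with hχ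
  -- `Q₁(c u) = χ · Q₂(u)`
  have hQ : Q₁.comp (Polynomial.C c * Polynomial.X) = Polynomial.C χ * Q₂ := by
    refine Polynomial.funext fun u => ?_
    rw [Polynomial.eval_comp, Polynomial.eval_mul, Polynomial.eval_C, Polynomial.eval_X, Polynomial.eval_mul,
      Polynomial.eval_C, ← h₂' u, ← hf.2 A B C hA hB hC, actTensor_add', actTensor_smul', hE, smul_smul, mul_comm u c,
      ← h₁' (c * u)]
  -- compare the `u^k` coefficients
  have hk : c ^ k * evalT (actTensor A B C y) g = χ * evalT y g := by
    have h := congrArg (fun P : Polynomial ℂ => P.coeff k) hQ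
    simp only [coeff_comp_C_mul_X', Polynomial.coeff_C_mul] at h
    rw [h₁, h₂] at h
    exact h
  have hχ' : χ = c ^ k * (weightChar (rectType (m' + 1) m' k 0) A * weightChar (rectType (m' + 1) m' k 1) B *
      weightChar (rectType (m' + 1) m' k 2) C) := by
    rw [hχ, weightChar_rectType_succ, weightChar_rectType_succ, weightChar_rectType_succ, hc]
    ring
  rw [hχ', mul_assoc] at hk
  exact mul_left_cancel₀ (pow_ne_zero k hc0) hk

end TopCoeffLevel

/-! ### §3 The even-split descent law -/

section EvenSplitDescent

variable {m' : ℕ}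

/-- **THE EVEN-SPLIT DESCENT LAW.**  Hypothesis (H20 at format `m'`, corner form): every level-`3` vector `G` of the
corner type `((3^{m'}))³` in format `m' + 1` has vanishing `(2,…,2)`-coefficient in `G(Σ_{i<n} λ_i t_i)` whenever
`2n = 3m'` and the `t_i` are triads.  Conclusion: every level-`3` vector of the full format `m' + 1` vanishes at every
tensor of rank `≤ r` with `2r + 1 ≤ 3(m' + 1)` — for even `m'` the odd Strassen step `r_{m'+1}(3) ≥ (3m' + 4)/2`
(`m' = 4`: `σ₇` at format `5`; `m' = 8`: `σ₁₃` at format `9`, census K25). [this node] -/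
theorem evalT_eq_zero_of_evenSplit_pred (hm : 1 ≤ m')
    (hES : ∀ G ∈ hwvSpace (rectType (m' + 1) m' 3) (3 * m'), ∀ (n : ℕ) (x₁ x₂ x₃ : Fin n → Fin (m' + 1) → ℂ),
      2 * n = 3 * m' → MvPolynomial.coeff (Finsupp.equivFunOnFinite.symm fun _ : Fin n => 2)
        (MvPolynomial.aeval (fun p : Idx (m' + 1) =>
          ∑ i : Fin n, MvPolynomial.C (triad (x₁ i) (x₂ i) (x₃ i) p.1 p.2.1 p.2.2) * MvPolynomial.X i) G) = 0)
    {f : MvPolynomial (Idx (m' + 1)) ℂ} (hf : f ∈ hwvSpace (rectType (m' + 1) (m' + 1) 3) (3 * (m' + 1)))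
    {r : ℕ} (hr : 2 * r + 1 ≤ 3 * (m' + 1)) {t : Tensor ℂ (m' + 1)} (ht : tensorRank t ≤ r) : evalT t f = 0 := by
  classical
  have hΛ : ∀ (s : Fin 3) (i : Fin (m' + 1)), rectType (m' + 1) (m' + 1) 3 s i = 3 := fun s i =>
    rectType_self_apply 3 s i
  have hEC := fun {μ : Idx (m' + 1) →₀ ℕ} (hμ : μ ∈ f.support) (p : Idx (m' + 1)) =>
    exponent_at_cell hf (hΛ 0 p.1) (hΛ 1 p.2.1) (hΛ 2 p.2.2) hμ
  have h2 : 2 ≤ m' + 1 := by omega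
  have hblock : ∀ a' b' c' : Fin (m' + 1), a' ≠ 0 → b' ≠ 0 → c' ≠ 0 → ∀ y : Tensor ℂ (m' + 1),
      evalT (fun x y' z =>
        if ((x = 0 ∨ x = a') ∧ (y' = 0 ∨ y' = b') ∧ (z = 0 ∨ z = c')) ∨
            (x ≠ 0 ∧ x ≠ a' ∧ y' ≠ 0 ∧ y' ≠ b' ∧ z ≠ 0 ∧ z ≠ c')
        then y x y' z else 0) f = 0 :=
    fun a' b' c' ha hb hc y => blockWindow_dead_of_emptyLevel_two (mem_emptyLevels_two_of_odd (k := 3) ⟨1, rfl⟩ h2)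
      hf ha hb hc y
  -- the top coefficient `g = f^{(e₀₀₀)}`
  obtain ⟨g, hghom, hgsupp, hgtop⟩ := exists_topCoeff hf (hΛ 0 0) (hΛ 1 0) (hΛ 2 0)
  -- (1) every exponent of `g` is `≤ 2`
  have hgexp : ∀ ν ∈ g.support, ∀ p : Idx (m' + 1), ν p ≤ 3 - 1 := by
    intro ν hν p
    obtain ⟨hνe, μ, hμ, hμe, hνμ⟩ := hgsupp ν hν
    by_cases hpe : p = (0, 0, 0)
    · rw [hpe, hνe]
      exact Nat.zero_le _
    rw [hνμ p hpe]
    have hle : μ p ≤ 3 := by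
      have h := (hEC hμ p).1
      simpa only [Prod.mk.eta] using h
    rcases Nat.lt_or_ge (μ p) 3 with hlt | hge
    · omega
    have hpk : μ p = 3 := le_antisymm hle hge
    exfalso
    have hps : p ∈ μ.support := Finsupp.mem_support_iff.mpr (by omega)
    obtain ⟨h1, h2', h3⟩ := (hEC hμ (0, 0, 0)).2.1 hμe p hps hpe
    refine MvPolynomial.mem_support_iff.mp hμ (coeff_eq_zero_of_evalT_kill f
      (fun x y' z => ((x = 0 ∨ x = p.1) ∧ (y' = 0 ∨ y' = p.2.1) ∧ (z = 0 ∨ z = p.2.2)) ∨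
        (x ≠ 0 ∧ x ≠ p.1 ∧ y' ≠ 0 ∧ y' ≠ p.2.1 ∧ z ≠ 0 ∧ z ≠ p.2.2))
      (hblock p.1 p.2.1 p.2.2 h1 h2' h3) fun q hq => ?_)
    by_cases hqe : q = (0, 0, 0)
    · rw [hqe]
      exact Or.inl ⟨Or.inl rfl, Or.inl rfl, Or.inl rfl⟩
    by_cases hqp : q = p
    · rw [hqp]
      exact Or.inl ⟨Or.inr rfl, Or.inr rfl, Or.inr rfl⟩
    obtain ⟨hq1, hq2, hq3⟩ := (hEC hμ (0, 0, 0)).2.1 hμe q hq hqe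
    have hp' := (hEC hμ p).2.1
    simp only [Prod.mk.eta] at hp'
    obtain ⟨hq1', hq2', hq3'⟩ := hp' hpk q hq hqp
    exact Or.inr ⟨hq1, hq1', hq2, hq2', hq3, hq3'⟩
  -- (2) line degree of `g` along every coordinate cell, then along every triad; `g` is a corner-type level vector
  have hgline : ∀ (a' b' c' : Fin (m' + 1)) (y : Tensor ℂ (m' + 1)), ∃ Q : Polynomial ℂ, Q.natDegree ≤ 3 - 1 ∧
      ∀ v : ℂ, evalT (y + v • triad (Pi.single a' 1) (Pi.single b' 1) (Pi.single c' 1)) g = Q.eval v :=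
    fun a' b' c' y => lineDegree_of_exponent_le (fun ν hν => hgexp ν hν (a', b', c')) y
  have hgtriad := lineDegree_topCoeff_triad hf hgtop hgline
  have hghom' : g.IsHomogeneous (3 * m') := by
    have h : 3 * (m' + 1) - 3 = 3 * m' := by omega
    rw [h] at hghom
    exact hghom
  have hgW : g ∈ hwvSpace (rectType (m' + 1) m' 3) (3 * m') := topCoeff_mem_hwvSpace_pred hf hghom' hgtop
  -- (3) the secant polynomial has degree `≤ 2` in every variable
  obtain ⟨x₁, x₂, x₃, rfl⟩ := exists_eq_sum_triad_of_tensorRank_le ht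
  set T : Fin r → Tensor ℂ (m' + 1) := fun i => triad (x₁ i) (x₂ i) (x₃ i) with hT
  have hΦ : MvPolynomial.aeval
      (fun p : Idx (m' + 1) => ∑ i : Fin r, MvPolynomial.C (T i p.1 p.2.1 p.2.2) * MvPolynomial.X i) f = 0 := by
    refine eq_zero_of_isHomogeneous_of_degreeOf_le (δ := 3 - 1) (secant_isHomogeneous T hf.1)
      (fun j => degreeOf_le_of_lineDegree j fun cc => ?_)
      (by simp only [Fintype.card_fin]; omega)
    obtain ⟨n, hn⟩ : ∃ n, r = n + 1 := ⟨r - 1, (Nat.succ_pred_eq_of_pos j.pos).symm⟩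
    subst hn
    -- base point: the other `n` summands
    set zb : Tensor ℂ (m' + 1) := ∑ l : Fin n, cc (j.succAbove l) • T (j.succAbove l) with hzb
    have hsplit : ∀ u : ℂ, (∑ i, Function.update cc j u i • T i) = u • T j + zb := by
      intro u
      rw [Fin.sum_univ_succAbove _ j, Function.update_self]
      congr 1
      refine Finset.sum_congr rfl fun l _ => ?_
      rw [Function.update_of_ne (Fin.succAbove_ne j l)]
    by_cases h0 : x₁ j = 0 ∨ x₂ j = 0 ∨ x₃ j = 0
    · refine ⟨Polynomial.C (evalT zb f), (Polynomial.natDegree_C _).le.trans (Nat.zero_le _), fun u => ?_⟩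
      rw [eval_secant, hsplit, hT]
      simp only
      rw [triad_eq_zero_of_factor h0, smul_zero, zero_add, Polynomial.eval_C]
    have h0' : x₁ j ≠ 0 ∧ x₂ j ≠ 0 ∧ x₃ j ≠ 0 :=
      ⟨fun h => h0 (Or.inl h), fun h => h0 (Or.inr (Or.inl h)), fun h => h0 (Or.inr (Or.inr h))⟩
    obtain ⟨A, B, C, hA, hB, hC, hABC⟩ := exists_actTensor_coord_eq_triad h0'.1 h0'.2.1 h0'.2.2
      (0 : Fin (m' + 1)) 0 0
    obtain ⟨χ, -, hχ⟩ := exists_evalT_actTensor_eq_mul hf (fun s i j => rectType_self_const 3 s i j) hA hB hC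
    have hzb' : zb = actTensor A B C (actTensor A⁻¹ B⁻¹ C⁻¹ zb) := by
      rw [actTensor_actTensor, Matrix.mul_nonsing_inv A (isUnit_iff_ne_zero.mpr hA),
        Matrix.mul_nonsing_inv B (isUnit_iff_ne_zero.mpr hB), Matrix.mul_nonsing_inv C (isUnit_iff_ne_zero.mpr hC),
        actTensor_one]
    -- `g` vanishes at `h⁻¹ zb`, a sum of `n` triads: by §1 applied to the corner-type level vector `g` (H20 input)
    have hg0 : evalT (actTensor A⁻¹ B⁻¹ C⁻¹ zb) g = 0 := by
      rw [hzb, actTensor_finset_sum]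
      have hdir : ∀ l : Fin n, actTensor A⁻¹ B⁻¹ C⁻¹ (cc (j.succAbove l) • T (j.succAbove l)) =
          triad (A⁻¹.mulVec (cc (j.succAbove l) • x₁ (j.succAbove l))) (B⁻¹.mulVec (x₂ (j.succAbove l)))
            (C⁻¹.mulVec (x₃ (j.succAbove l))) := by
        intro l
        rw [hT]
        simp only
        rw [smul_triad, actTensor_triad]
      simp only [hdir]
      set T' : Fin n → Tensor ℂ (m' + 1) := fun l =>
        triad (A⁻¹.mulVec (cc (j.succAbove l) • x₁ (j.succAbove l))) (B⁻¹.mulVec (x₂ (j.succAbove l)))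
          (C⁻¹.mulVec (x₃ (j.succAbove l))) with hT'
      have hsec : MvPolynomial.aeval
          (fun p : Idx (m' + 1) => ∑ i : Fin n, MvPolynomial.C (T' i p.1 p.2.1 p.2.2) * MvPolynomial.X i) g = 0 :=
        secant_eq_zero_of_coeff hghom' T' (fun w l => hgtriad _ _ _ w) (by omega)
          fun hn => hES g hgW n _ _ _ hn
      have h := eval_secant T' g fun _ => 1
      rw [hsec, map_zero] at h
      simpa only [one_smul] using h.symm
    obtain ⟨Q₀, hQ₀deg, hQ₀top, hQ₀⟩ := hgtop (actTensor A⁻¹ B⁻¹ C⁻¹ zb)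
    rw [hg0] at hQ₀top
    have hQ₀deg' : Q₀.natDegree ≤ 3 - 1 := by
      by_contra hlt
      have hk : Q₀.natDegree = 3 := le_antisymm hQ₀deg (by omega)
      have hlc : Q₀.leadingCoeff = 0 := by rw [Polynomial.leadingCoeff, hk, hQ₀top]
      rw [Polynomial.leadingCoeff_eq_zero] at hlc
      rw [hlc, Polynomial.natDegree_zero] at hk
      omega
    refine ⟨Polynomial.C χ * Q₀, (Polynomial.natDegree_C_mul_le _ _).trans hQ₀deg', fun u => ?_⟩
    rw [eval_secant, hsplit, Polynomial.eval_mul, Polynomial.eval_C, ← hQ₀ u, ← hχ, actTensor_add',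
      actTensor_smul', ← hzb', hABC, add_comm (u • T j) zb]
  have h := eval_secant T f fun _ => 1
  rw [hΦ, map_zero] at h
  simpa only [one_smul] using h.symm

/-- Level language: under H20 at format `m'`, `3` is not a level of any tensor of format `m' + 1` and rank `≤ r`,
`2r + 1 ≤ 3(m' + 1)`. [this node] -/
theorem three_not_mem_pointLevels_of_evenSplit_pred (hm : 1 ≤ m')
    (hES : ∀ G ∈ hwvSpace (rectType (m' + 1) m' 3) (3 * m'), ∀ (n : ℕ) (x₁ x₂ x₃ : Fin n → Fin (m' + 1) → ℂ),
      2 * n = 3 * m' → MvPolynomial.coeff (Finsupp.equivFunOnFinite.symm fun _ : Fin n => 2)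
        (MvPolynomial.aeval (fun p : Idx (m' + 1) =>
          ∑ i : Fin n, MvPolynomial.C (triad (x₁ i) (x₂ i) (x₃ i) p.1 p.2.1 p.2.2) * MvPolynomial.X i) G) = 0)
    {r : ℕ} (hr : 2 * r + 1 ≤ 3 * (m' + 1)) {t : Tensor ℂ (m' + 1)} (ht : tensorRank t ≤ r) :
    3 ∉ pointLevels (m' + 1) t := by
  rintro ⟨f, hf, hne⟩
  exact hne (evalT_eq_zero_of_evenSplit_pred hm hES hf hr ht)

/-- **Vacuous H20.**  If level `3` is EMPTY at format `m'` (tower hypothesis `3 ∈ emptyLevels m' m'`, e.g. `m' = 2`: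
`k₂(3) = 0`; `m' = 7`, `m' ≥ 10`), the even-split hypothesis at format `m'` holds vacuously, and the even-split descent
law specialises to part U's descent law at level `3` (same range `2r + 1 ≤ 3(m'+1)`). [this node] -/
theorem evenSplit_pred_of_emptyLevel (hk : 3 ∈ emptyLevels m' m') :
    ∀ G ∈ hwvSpace (rectType (m' + 1) m' 3) (3 * m'), ∀ (n : ℕ) (x₁ x₂ x₃ : Fin n → Fin (m' + 1) → ℂ),
      2 * n = 3 * m' → MvPolynomial.coeff (Finsupp.equivFunOnFinite.symm fun _ : Fin n => 2)
        (MvPolynomial.aeval (fun p : Idx (m' + 1) =>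
          ∑ i : Fin n, MvPolynomial.C (triad (x₁ i) (x₂ i) (x₃ i) p.1 p.2.1 p.2.2) * MvPolynomial.X i) G) = 0 := by
  intro G hG n x₁ x₂ x₃ _
  have hbot : hwvSpace (rectType (m' + 1) m' 3) (3 * m') = ⊥ := (mem_emptyLevels_iff_self (Nat.le_succ m')).mpr hk
  rw [hbot, Submodule.mem_bot] at hG
  rw [hG, map_zero, MvPolynomial.coeff_zero]

/-- H20 at format `2` holds (vacuously: `3 ∈ emptyLevels 2 2`, part N) — with `evalT_eq_zero_of_evenSplit_pred` at
`m' = 2` this is a second route to Strassen's range `R₃(3) ⊆ I(σ₄)` (part U `evalT_eq_zero_of_level_three_three`).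
[this node] [cite: BurgisserIkenmeyer2011, §6.2] -/
theorem evenSplit_pred_two :
    ∀ G ∈ hwvSpace (rectType (2 + 1) 2 3) (3 * 2), ∀ (n : ℕ) (x₁ x₂ x₃ : Fin n → Fin (2 + 1) → ℂ),
      2 * n = 3 * 2 → MvPolynomial.coeff (Finsupp.equivFunOnFinite.symm fun _ : Fin n => 2)
        (MvPolynomial.aeval (fun p : Idx (2 + 1) =>
          ∑ i : Fin n, MvPolynomial.C (triad (x₁ i) (x₂ i) (x₃ i) p.1 p.2.1 p.2.2) * MvPolynomial.X i) G) = 0 :=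
  evenSplit_pred_of_emptyLevel (mem_emptyLevels_two_two_of_odd (k := 3) ⟨1, rfl⟩)

end EvenSplitDescent

end Summit.MatrixMultiplication.MatrixMultiplication.Theorems.ObstructionCalculus
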